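import Literature.Analysis.FluidPDE.TaoAveragedEuler
import Literature.Analysis.FluidPDE.TaoAveragedEulerLerayL2
import Literature.Analysis.FluidPDE.TaoAveragedEulerContDiff
import Literature.Analysis.FluidPDE.NSBoundedMildOseenClassical
import HarnessLib

/-!
# Crux `OddMorawetz.MorawetzKillsTypeI` (stmt-NavierStokesRegularity-1377), line `birth`:
  STUB `stub_divFree_eulerBilinear`, the Euler bilinear term of a Schwartz field is divergence free

For a Schwartz vector field `v` on `ℝ³` the (function-level) Euler bilinear operator
`B(v,v) = -½ P[(v·∇)v + (v·∇)v]` (`Literature.Analysis.FluidPDE.eulerBilinear`, `P` the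
function-level Leray projector `lerayProjFun`) is pointwise divergence free,
`div B(v,v) = 0` (`Literature.Analysis.FluidPDE.VectorCalculus.IsDivFree`). The lead's skeleton
feeds `b = B(v,v)` to the weight-one null-Lagrangian identity, which needs `div b = 0` pointwise.

Proof (assembly of tree facts, no new definitions, no named unproved facts):
* `φ := (v·∇)v + (v·∇)v` is a Schwartz field (`ContDiffEuler.isSchwartzField_convect_add`);
* hence `P φ` is weakly divergence free (`IsSchwartzField.isWeaklyDivFree_lerayProjFun`,
  Lemarié-Rieusset 2002, Ch. 11), and so is its scalar multiple `B(v,v) = -½ • P φ`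
  (`isWeaklyDivFree_const_smul`, linearity of `∫ ⟪·, ∇θ⟫`);
* `B(v,v)` is `C^∞` (`contDiff_eulerBilinear_holds`), so weak incompressibility upgrades to
  pointwise incompressibility (`IsWeaklyDivFree.isDivFree_of_contDiff`, du Bois-Reymond).
The divergence-free hypothesis on `v` is not used (the Leray projection kills every gradient part).

Lands `--supports stmt-NavierStokesRegularity-1377`.
-/

noncomputable section

-- the problem namespace `Summit.NavierStokesRegularity.NavierStokesRegularity` repeats the summit name by design (D-0017)
set_option linter.dupNamespace false

namespace Summit.NavierStokesRegularity.NavierStokesRegularity.Theorems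

open MeasureTheory
open scoped RealInnerProductSpace
open Literature.Analysis Literature.Analysis.FluidPDE

/-- **Scalar multiples of weakly divergence-free fields are weakly divergence free.** If
`∫ ⟪u, ∇θ⟫ = 0` for every test function `θ` (`IsWeaklyDivFree u`), then the same holds for `c • u`,
since `∫ ⟪c • u, ∇θ⟫ = c ∫ ⟪u, ∇θ⟫` (linearity of the Bochner integral; no integrability needed,
`integral_const_mul` is unconditional). -/
theorem isWeaklyDivFree_const_smul {E : Type*} [NormedAddCommGroup E] [InnerProductSpace ℝ E]
    [FiniteDimensional ℝ E] [MeasurableSpace E] [BorelSpace E] {u : E → E}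
    (hu : IsWeaklyDivFree u) (c : ℝ) : IsWeaklyDivFree (c • u) := by
  intro θ hθ
  have h : ∀ x, ⟪(c • u) x, gradient θ x⟫ = c * ⟪u x, gradient θ x⟫ := fun x => by
    rw [Pi.smul_apply, real_inner_smul_left]
  simp_rw [h, integral_const_mul, hu θ hθ, mul_zero]

/-- **Stub `stub_divFree_eulerBilinear`** (crux `OddMorawetz.MorawetzKillsTypeI`,
stmt-NavierStokesRegularity-1377, line `birth`). For a Schwartz (divergence-free) field `v` on `ℝ³`,
the Euler bilinear term `B(v,v) = -½ P[(v·∇)v + (v·∇)v]` is pointwise divergence free: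
`P φ` of the Schwartz field `φ = 2 (v·∇)v` is weakly divergence free
(`IsSchwartzField.isWeaklyDivFree_lerayProjFun`), so is `-½ • P φ`, and `B(v,v)` is smooth
(`contDiff_eulerBilinear_holds`), whence `div B(v,v) = 0` everywhere
(`IsWeaklyDivFree.isDivFree_of_contDiff`). -/
theorem stub_divFree_eulerBilinear :
    ∀ v : EuclideanSpace ℝ (Fin 3) → EuclideanSpace ℝ (Fin 3),
      Literature.Analysis.FluidPDE.IsSchwartzField v → Literature.Analysis.FluidPDE.VectorCalculus.IsDivFree v →
      Literature.Analysis.FluidPDE.VectorCalculus.IsDivFree (Literature.Analysis.FluidPDE.eulerBilinear v v) := by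
  intro v hv _
  -- the symmetrised convective term is Schwartz, so its Leray projection is weakly divergence free
  have hφ : IsSchwartzField fun x => convect v v x + convect v v x :=
    ContDiffEuler.isSchwartzField_convect_add hv hv
  have hweak : IsWeaklyDivFree (eulerBilinear v v) :=
    isWeaklyDivFree_const_smul hφ.isWeaklyDivFree_lerayProjFun (-(2 : ℝ)⁻¹)
  -- `B(v,v)` is smooth, hence `C¹`
  have h1 : ContDiff ℝ 1 (eulerBilinear v v) :=
    (contDiff_eulerBilinear_holds hv hv).1.of_le (by exact_mod_cast le_top)
  exact hweak.isDivFree_of_contDiff h1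

end Summit.NavierStokesRegularity.NavierStokesRegularity.Theorems
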